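import Mathlib
import Literature.NumberTheory.Transcendental.KZCalculusProofs
import Literature.NumberTheory.Transcendental.KZLogCalculusProofs
import Literature.NumberTheory.Transcendental.KZSemialgebraicComplex
import Literature.NumberTheory.Transcendental.SemialgebraicMapsProofs
import Literature.NumberTheory.Transcendental.KZIntervalPeriodProofs

/-!
# `OffTetraSectorKernel`, line `odd-hyperbolic-ladder`: the geodesic fan of the sphere (`stub_sphereFan`)

Stub `stub_sphereFan` of the crux `OffTetraSectorKernel` (stmt-KontsevichZagierPeriods-10557,
route HyperbolicBloch), spherical rung 1 (Girard's theorem inside the Kontsevich–Zagier calculus).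
In the stereographic chart of the unit sphere the area density is `4/(1 + x² + y²)²`; a great
circle not through the poles is the circle `|p − c|² = 1 + |c|²`, `c = (c₁, c₂)`, rationally
parametrised by
`p(τ) = (p₀(τ), p₁(τ)) = (c₁ + R(1 − τ²)/(1 + τ²), c₂ + 2Rτ/(1 + τ²))`, `R² = 1 + c₁² + c₂²`,
with `p′(τ) = (−4Rτ, 2R(1 − τ²))/(1 + τ²)²`. The GEODESIC FAN from the origin over the arc
`p((τ₁, τ₂))` is the image of the rectangle `W = (τ₁, τ₂) × (0, 1)` (coordinates `z 0 = τ`,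
`z 1 = λ`) under the fan map `Φ(τ, λ) = λ · p(τ)`.

This file proves that `[W, 4λJ/(1 + λ²P)²] − [Φ(W), 4/(1 + x² + y²)²]` is ONE change-of-variables
move (rule (2), `KZ.changeOfVariablesRel ⊆ KZ.relations`), where `J = p₀p₁′ − p₁p₀′` and
`P = p₀² + p₁²`:

* `Φ` is a `ℚ`-semialgebraic map (rational components with real-algebraic coefficients);
* its derivative at `(τ, λ)` is the linear map of matrix `!![λp₀′, p₀; λp₁′, p₁]`, of determinant
  `−λJ`; the MAGIC IDENTITY `J(τ)(1 + τ²) = 1 + P(τ)` gives `J > 0`, so `|det| = λJ` on `λ > 0`;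
* `Φ` is injective on `{λ > 0}`: both `p(τ)` and `(λ/λ′)p(τ)` lie on the circle
  `|x|² − 2c·x − 1 = 0` only if `λ = λ′`, and `τ ↦ p(τ)` is injective;
* `4λJ/(1 + λ²P)² = 4/(1 + (λp₀)² + (λp₁)²)² · λJ`.

Layout and the map lemmas follow the siblings `…StubDilogShear.lean` (`dilogShear_map_*`) and
`…StubDilogLanden.lean` (`dilogLanden_map_*`). No definitions are introduced.

References: M. Kontsevich, D. Zagier, *Periods* (2001), §1.2 rule (2); J. Bochnak, M. Coste,
M.-F. Roy, *Real Algebraic Geometry* (1998), §2.2.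
-/

noncomputable section

open Set MeasureTheory MvPolynomial
open Literature.NumberTheory.Transcendental Literature.ModelTheory.ExponentialFields

namespace Summit.KontsevichZagierPeriods.HyperbolicBloch.OffTetraSectorKernel

/-! ### Scalar facts about the rational parametrisation `p(τ)` of the great circle -/

/-- Derivative of the first coordinate `p₀(τ) = c₁ + R(1 − τ²)/(1 + τ²)`:
`p₀′(τ) = −4Rτ/(1 + τ²)²`. [folklore] -/
theorem sphereFan_hasDerivAt_fst (c₁ R t : ℝ) :
    HasDerivAt (fun s : ℝ => c₁ + R * (1 - s ^ 2) / (1 + s ^ 2))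
      (-4 * R * t / (1 + t ^ 2) ^ 2) t := by
  have h1 : (1 + t ^ 2) ≠ 0 := by positivity
  have h := ((((hasDerivAt_pow 2 t).const_sub 1).const_mul R).fun_div
    ((hasDerivAt_pow 2 t).const_add 1) h1).const_add c₁
  refine h.congr_deriv ?_
  field_simp
  push_cast
  ring

/-- Derivative of the second coordinate `p₁(τ) = c₂ + 2Rτ/(1 + τ²)`:
`p₁′(τ) = 2R(1 − τ²)/(1 + τ²)²`. [folklore] -/
theorem sphereFan_hasDerivAt_snd (c₂ R t : ℝ) :
    HasDerivAt (fun s : ℝ => c₂ + 2 * R * s / (1 + s ^ 2))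
      (2 * R * (1 - t ^ 2) / (1 + t ^ 2) ^ 2) t := by
  have h1 : (1 + t ^ 2) ≠ 0 := by positivity
  have h := (((hasDerivAt_id' t).const_mul (2 * R)).fun_div
    ((hasDerivAt_pow 2 t).const_add 1) h1).const_add c₂
  refine h.congr_deriv ?_
  field_simp
  push_cast
  ring

/-- The point `p(τ)` lies on the great circle `|x|² − 2 c·x − 1 = 0` (radius `R`,
`R² = 1 + c₁² + c₂²`, centre `c`). [folklore] -/
theorem sphereFan_circle (c₁ c₂ : ℝ) {R : ℝ} (hR : R ^ 2 = 1 + c₁ ^ 2 + c₂ ^ 2) (τ : ℝ) :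
    (c₁ + R * (1 - τ ^ 2) / (1 + τ ^ 2)) ^ 2 + (c₂ + 2 * R * τ / (1 + τ ^ 2)) ^ 2 -
      2 * (c₁ * (c₁ + R * (1 - τ ^ 2) / (1 + τ ^ 2)) + c₂ * (c₂ + 2 * R * τ / (1 + τ ^ 2))) -
        1 = 0 := by
  have h : (1 + τ ^ 2) ≠ 0 := by positivity
  field_simp
  linear_combination (1 + τ ^ 2) ^ 2 * hR

/-- **The magic identity makes the Jacobian positive**: `J(τ)(1 + τ²) = 1 + P(τ)` with
`J = p₀p₁′ − p₁p₀′`, `P = p₀² + p₁²`, hence `J(τ) > 0` (the origin is inside the circle).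
[folklore] -/
theorem sphereFan_jac_pos (c₁ c₂ : ℝ) {R : ℝ} (hR : R ^ 2 = 1 + c₁ ^ 2 + c₂ ^ 2) (τ : ℝ) :
    0 < (c₁ + R * (1 - τ ^ 2) / (1 + τ ^ 2)) * (2 * R * (1 - τ ^ 2) / (1 + τ ^ 2) ^ 2) -
      (c₂ + 2 * R * τ / (1 + τ ^ 2)) * (-4 * R * τ / (1 + τ ^ 2) ^ 2) := by
  have h1 : (0 : ℝ) < 1 + τ ^ 2 := by positivity
  -- the magic identity `J (1 + τ²) = 1 + P`
  have hmagic : ((c₁ + R * (1 - τ ^ 2) / (1 + τ ^ 2)) * (2 * R * (1 - τ ^ 2) / (1 + τ ^ 2) ^ 2) -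
      (c₂ + 2 * R * τ / (1 + τ ^ 2)) * (-4 * R * τ / (1 + τ ^ 2) ^ 2)) * (1 + τ ^ 2) =
      1 + ((c₁ + R * (1 - τ ^ 2) / (1 + τ ^ 2)) ^ 2 + (c₂ + 2 * R * τ / (1 + τ ^ 2)) ^ 2) := by
    have h : (1 + τ ^ 2) ≠ 0 := h1.ne'
    field_simp
    linear_combination (1 + τ ^ 2) ^ 2 * hR
  have h2 : 0 < ((c₁ + R * (1 - τ ^ 2) / (1 + τ ^ 2)) * (2 * R * (1 - τ ^ 2) / (1 + τ ^ 2) ^ 2) -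
      (c₂ + 2 * R * τ / (1 + τ ^ 2)) * (-4 * R * τ / (1 + τ ^ 2) ^ 2)) * (1 + τ ^ 2) := by
    rw [hmagic]
    positivity
  exact pos_of_mul_pos_left h2 h1.le

/-- Two points of the circle `|x|² − 2 c·x − 1 = 0` on the same open ray from the origin coincide:
if `a p = b q` with `a, b > 0` and `p, q` on the circle then `a = b`
(`(a − b)(a|p|² + b) = 0`). [folklore] -/
theorem sphereFan_scale_eq {a b p0 p1 q0 q1 c₁ c₂ : ℝ} (ha : 0 < a) (hb : 0 < b)
    (h1 : a * p0 = b * q0) (h2 : a * p1 = b * q1)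
    (hp : p0 ^ 2 + p1 ^ 2 - 2 * (c₁ * p0 + c₂ * p1) - 1 = 0)
    (hq : q0 ^ 2 + q1 ^ 2 - 2 * (c₁ * q0 + c₂ * q1) - 1 = 0) : a = b := by
  have e1 : (a * p0) ^ 2 + (a * p1) ^ 2 = (b * q0) ^ 2 + (b * q1) ^ 2 := by rw [h1, h2]
  have e2 : a * (c₁ * p0 + c₂ * p1) = b * (c₁ * q0 + c₂ * q1) := by
    linear_combination c₁ * h1 + c₂ * h2
  have key : (a - b) * (a * (p0 ^ 2 + p1 ^ 2) + b) = 0 := by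
    linear_combination e1 + b ^ 2 * hq - a * b * hp - 2 * b * e2
  have hpos : 0 < a * (p0 ^ 2 + p1 ^ 2) + b := by positivity
  rcases mul_eq_zero.mp key with h | h
  · exact sub_eq_zero.mp h
  · exact absurd h hpos.ne'

/-- The parametrisation `τ ↦ p(τ)` is injective (`R ≠ 0`): equality of the first coordinates
forces `τ² = σ²`, and then equality of the second ones forces `τ = σ`. [folklore] -/
theorem sphereFan_param_inj {c₁ c₂ R τ σ : ℝ} (hR : R ≠ 0)
    (h0 : c₁ + R * (1 - τ ^ 2) / (1 + τ ^ 2) = c₁ + R * (1 - σ ^ 2) / (1 + σ ^ 2))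
    (h1 : c₂ + 2 * R * τ / (1 + τ ^ 2) = c₂ + 2 * R * σ / (1 + σ ^ 2)) : τ = σ := by
  have hτ : (1 + τ ^ 2) ≠ 0 := by positivity
  have hσ : (1 + σ ^ 2) ≠ 0 := by positivity
  have h0' : R * (1 - τ ^ 2) / (1 + τ ^ 2) = R * (1 - σ ^ 2) / (1 + σ ^ 2) := add_left_cancel h0
  have h1' : 2 * R * τ / (1 + τ ^ 2) = 2 * R * σ / (1 + σ ^ 2) := add_left_cancel h1
  rw [div_eq_div_iff hτ hσ] at h0' h1'
  have hsq : τ ^ 2 - σ ^ 2 = 0 := by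
    have h : R * (τ ^ 2 - σ ^ 2) = 0 := by linear_combination (-1 / 2 : ℝ) * h0'
    exact (mul_eq_zero.mp h).resolve_left hR
  have h2 : 2 * R * (1 + σ ^ 2) * (τ - σ) = 0 := by
    linear_combination h1' + 2 * R * σ * hsq
  have hne : 2 * R * (1 + σ ^ 2) ≠ 0 := mul_ne_zero (mul_ne_zero two_ne_zero hR) hσ
  exact sub_eq_zero.mp ((mul_eq_zero.mp h2).resolve_left hne)

/-! ### The fan map `Φ(τ, λ) = λ · p(τ)` of the plane -/

/-- First coordinate of the fan map: `Φ z 0 = z 1 * p₀(z 0)`. [folklore] -/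
theorem sphereFan_map_apply_zero (Φ : (Fin 2 → ℝ) → (Fin 2 → ℝ)) {c₁ c₂ R : ℝ}
    (hΦ : ∀ z, Φ z = ![z 1 * (c₁ + R * (1 - z 0 ^ 2) / (1 + z 0 ^ 2)),
      z 1 * (c₂ + 2 * R * z 0 / (1 + z 0 ^ 2))]) (z : Fin 2 → ℝ) :
    Φ z 0 = z 1 * (c₁ + R * (1 - z 0 ^ 2) / (1 + z 0 ^ 2)) := by
  rw [hΦ]
  rfl

/-- Second coordinate of the fan map: `Φ z 1 = z 1 * p₁(z 0)`. [folklore] -/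
theorem sphereFan_map_apply_one (Φ : (Fin 2 → ℝ) → (Fin 2 → ℝ)) {c₁ c₂ R : ℝ}
    (hΦ : ∀ z, Φ z = ![z 1 * (c₁ + R * (1 - z 0 ^ 2) / (1 + z 0 ^ 2)),
      z 1 * (c₂ + 2 * R * z 0 / (1 + z 0 ^ 2))]) (z : Fin 2 → ℝ) :
    Φ z 1 = z 1 * (c₂ + 2 * R * z 0 / (1 + z 0 ^ 2)) := by
  rw [hΦ]
  rfl

/-- **The fan map is injective on the half-plane `{λ > 0}`**: if `λ p(τ) = λ′ p(τ′)` then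
`λ = λ′` (two points of the circle on one open ray coincide) and then `τ = τ′`. [folklore] -/
theorem sphereFan_map_injOn (Φ : (Fin 2 → ℝ) → (Fin 2 → ℝ)) {c₁ c₂ R : ℝ}
    (hΦ : ∀ z, Φ z = ![z 1 * (c₁ + R * (1 - z 0 ^ 2) / (1 + z 0 ^ 2)),
      z 1 * (c₂ + 2 * R * z 0 / (1 + z 0 ^ 2))])
    (hR2 : R ^ 2 = 1 + c₁ ^ 2 + c₂ ^ 2) (hR : R ≠ 0) :
    InjOn Φ {z : Fin 2 → ℝ | 0 < z 1} := by
  intro a ha b hb h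
  have ha1 : (0 : ℝ) < a 1 := ha
  have hb1 : (0 : ℝ) < b 1 := hb
  have e0 : a 1 * (c₁ + R * (1 - a 0 ^ 2) / (1 + a 0 ^ 2)) =
      b 1 * (c₁ + R * (1 - b 0 ^ 2) / (1 + b 0 ^ 2)) := by
    rw [← sphereFan_map_apply_zero Φ hΦ a, ← sphereFan_map_apply_zero Φ hΦ b, h]
  have e1 : a 1 * (c₂ + 2 * R * a 0 / (1 + a 0 ^ 2)) =
      b 1 * (c₂ + 2 * R * b 0 / (1 + b 0 ^ 2)) := by
    rw [← sphereFan_map_apply_one Φ hΦ a, ← sphereFan_map_apply_one Φ hΦ b, h]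
  have hl : a 1 = b 1 :=
    sphereFan_scale_eq ha1 hb1 e0 e1 (sphereFan_circle c₁ c₂ hR2 (a 0))
      (sphereFan_circle c₁ c₂ hR2 (b 0))
  rw [hl] at e0 e1
  have ht : a 0 = b 0 :=
    sphereFan_param_inj hR (mul_left_cancel₀ hb1.ne' e0) (mul_left_cancel₀ hb1.ne' e1)
  funext i
  fin_cases i
  exacts [ht, hl]

/-- **The fan map is a `ℚ`-semialgebraic map** on every `ℚ`-semialgebraic set: its components are
products of a coordinate with rational functions of the other coordinate (denominator
`1 + τ² ≠ 0`) having real-algebraic coefficients `c₁, c₂, R`. [folklore] -/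
theorem sphereFan_map_isSemialgebraicMapOn (Φ : (Fin 2 → ℝ) → (Fin 2 → ℝ)) {c₁ c₂ R : ℝ}
    (hΦ : ∀ z, Φ z = ![z 1 * (c₁ + R * (1 - z 0 ^ 2) / (1 + z 0 ^ 2)),
      z 1 * (c₂ + 2 * R * z 0 / (1 + z 0 ^ 2))])
    (hc₁ : IsAlgebraic ℚ c₁) (hc₂ : IsAlgebraic ℚ c₂) (hR : IsAlgebraic ℚ R)
    {σ : Set (Fin 2 → ℝ)} (hσ : IsSemialgebraic ℚ σ) :
    IsSemialgebraicMapOn ℚ σ Φ := by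
  have hq : ∀ z ∈ σ, aeval z (1 + X 0 ^ 2 : MvPolynomial (Fin 2) ℚ) ≠ 0 := fun z _ => by
    have : (0 : ℝ) < 1 + z 0 ^ 2 := by positivity
    simpa only [map_add, map_one, map_pow, MvPolynomial.aeval_X] using this.ne'
  have hr0 : IsSemialgebraicFunOn ℚ σ (fun z => (1 - z 0 ^ 2) / (1 + z 0 ^ 2)) :=
    (isSemialgebraicFunOn_aeval_div_aeval hσ (1 - X 0 ^ 2) (1 + X 0 ^ 2) hq).congr
      fun z _ => by simp
  have hr1 : IsSemialgebraicFunOn ℚ σ (fun z => 2 * z 0 / (1 + z 0 ^ 2)) :=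
    (isSemialgebraicFunOn_aeval_div_aeval hσ (2 * X 0) (1 + X 0 ^ 2) hq).congr
      fun z _ => by simp
  have hP0 : IsSemialgebraicFunOn ℚ σ
      (fun z => z 1 * (c₁ + R * (1 - z 0 ^ 2) / (1 + z 0 ^ 2))) :=
    (IsSemialgebraicFunOn.mul_holds (isSemialgebraicFunOn_apply hσ 1)
      (IsSemialgebraicFunOn.add_holds (isSemialgebraicFunOn_const_of_isAlgebraic hσ hc₁)
        (IsSemialgebraicFunOn.mul_holds (isSemialgebraicFunOn_const_of_isAlgebraic hσ hR)
          hr0))).congr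
      fun z _ => by simp only [Pi.add_apply, Pi.mul_apply]; ring
  have hP1 : IsSemialgebraicFunOn ℚ σ
      (fun z => z 1 * (c₂ + 2 * R * z 0 / (1 + z 0 ^ 2))) :=
    (IsSemialgebraicFunOn.mul_holds (isSemialgebraicFunOn_apply hσ 1)
      (IsSemialgebraicFunOn.add_holds (isSemialgebraicFunOn_const_of_isAlgebraic hσ hc₂)
        (IsSemialgebraicFunOn.mul_holds (isSemialgebraicFunOn_const_of_isAlgebraic hσ hR)
          hr1))).congr
      fun z _ => by simp only [Pi.add_apply, Pi.mul_apply]; ring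
  refine IsSemialgebraicMapOn.of_forall hσ fun j => ?_
  fin_cases j
  · exact hP0.congr fun z _ => by rw [hΦ]; rfl
  · exact hP1.congr fun z _ => by rw [hΦ]; rfl

/-- **The derivative of the fan map and its determinant.** At every point `p = (τ, λ)` the linear
map `L` of matrix `!![λp₀′(τ), p₀(τ); λp₁′(τ), p₁(τ)]` is the Fréchet derivative of `Φ`, and
`det L = −λ J(τ)` with `J = p₀p₁′ − p₁p₀′`. [folklore] -/
theorem sphereFan_map_hasFDerivAt_det (Φ : (Fin 2 → ℝ) → (Fin 2 → ℝ)) {c₁ c₂ R : ℝ}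
    (hΦ : ∀ z, Φ z = ![z 1 * (c₁ + R * (1 - z 0 ^ 2) / (1 + z 0 ^ 2)),
      z 1 * (c₂ + 2 * R * z 0 / (1 + z 0 ^ 2))]) (p : Fin 2 → ℝ) :
    ∃ L : (Fin 2 → ℝ) →L[ℝ] (Fin 2 → ℝ), HasFDerivAt Φ L p ∧
      L.det = -(p 1 * ((c₁ + R * (1 - p 0 ^ 2) / (1 + p 0 ^ 2)) *
          (2 * R * (1 - p 0 ^ 2) / (1 + p 0 ^ 2) ^ 2) -
        (c₂ + 2 * R * p 0 / (1 + p 0 ^ 2)) * (-4 * R * p 0 / (1 + p 0 ^ 2) ^ 2))) := by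
  -- layout of `dilogShear_map_hasFDerivAt_det` / `dilogLanden_map_hasFDerivAt_det`
  set M : Matrix (Fin 2) (Fin 2) ℝ :=
    !![p 1 * (-4 * R * p 0 / (1 + p 0 ^ 2) ^ 2), c₁ + R * (1 - p 0 ^ 2) / (1 + p 0 ^ 2);
      p 1 * (2 * R * (1 - p 0 ^ 2) / (1 + p 0 ^ 2) ^ 2), c₂ + 2 * R * p 0 / (1 + p 0 ^ 2)] with hM
  refine ⟨LinearMap.toContinuousLinearMap (Matrix.toLin' M), ?_, ?_⟩
  · have q0 : HasFDerivAt (fun y : Fin 2 → ℝ => y 0)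
        (ContinuousLinearMap.proj (R := ℝ) (φ := fun _ : Fin 2 => ℝ) 0) p := hasFDerivAt_apply 0 p
    have q1 : HasFDerivAt (fun y : Fin 2 → ℝ => y 1)
        (ContinuousLinearMap.proj (R := ℝ) (φ := fun _ : Fin 2 => ℝ) 1) p := hasFDerivAt_apply 1 p
    refine hasFDerivAt_pi'' fun i => ?_
    fin_cases i
    · have hf : (fun x => Φ x 0) = fun y : Fin 2 → ℝ =>
          y 1 * ((fun s : ℝ => c₁ + R * (1 - s ^ 2) / (1 + s ^ 2)) ∘ fun x : Fin 2 → ℝ => x 0) y := by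
        funext x
        rw [hΦ]
        rfl
      simp only [Fin.zero_eta]
      rw [hf]
      refine (q1.mul ((sphereFan_hasDerivAt_fst c₁ R (p 0)).comp_hasFDerivAt p q0)).congr_fderiv
        ?_
      ext v
      simp [hM, Matrix.toLin'_apply, dotProduct, Fin.sum_univ_two]
      ring
    · have hf : (fun x => Φ x 1) = fun y : Fin 2 → ℝ =>
          y 1 * ((fun s : ℝ => c₂ + 2 * R * s / (1 + s ^ 2)) ∘ fun x : Fin 2 → ℝ => x 0) y := by
        funext x
        rw [hΦ]
        rfl
      simp only [Fin.mk_one]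
      rw [hf]
      refine (q1.mul ((sphereFan_hasDerivAt_snd c₂ R (p 0)).comp_hasFDerivAt p q0)).congr_fderiv
        ?_
      ext v
      simp [hM, Matrix.toLin'_apply, dotProduct, Fin.sum_univ_two]
      ring
  · rw [LinearMap.det_toContinuousLinearMap, LinearMap.det_toLin', hM, Matrix.det_fin_two_of]
    ring

/-! ### The move -/

/-- **The fan move**: for real algebraic `c₁, c₂, R` with `R > 0`, `R² = 1 + c₁² + c₂²`, the
rectangle `W = [(τ₁,τ₂) × (0,1), 4λJ/(1 + λ²P)²]` and the geodesic fan
`T = [Φ(W), 4/(1 + x² + y²)²]` satisfy `[W] − [T] ∈ KZ.relations` — ONE change-of-variables move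
along `Φ(τ, λ) = λ p(τ)` (Jacobian `λJ`, `J > 0` by the magic identity `J(1+τ²) = 1 + P`).
[cite: KontsevichZagier2001, §1.2 rule (2)] -/
theorem sphereFan_rect_sub_fan {c₁ c₂ R τ₁ τ₂ : ℝ} (hc₁ : IsAlgebraic ℚ c₁)
    (hc₂ : IsAlgebraic ℚ c₂) (hRa : IsAlgebraic ℚ R) (hR0 : 0 < R)
    (hR2 : R ^ 2 = 1 + c₁ ^ 2 + c₂ ^ 2) (W T : KZ.IntegralRep 2)
    (hWd : W.domain = {z | τ₁ < z 0 ∧ z 0 < τ₂ ∧ 0 < z 1 ∧ z 1 < 1})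
    (hWi : EqOn W.integrand (fun z => 4 * z 1 * ((c₁ + R * (1 - z 0 ^ 2) / (1 + z 0 ^ 2)) *
        (2 * R * (1 - z 0 ^ 2) / (1 + z 0 ^ 2) ^ 2) - (c₂ + 2 * R * z 0 / (1 + z 0 ^ 2)) *
        (-4 * R * z 0 / (1 + z 0 ^ 2) ^ 2)) / (1 + z 1 ^ 2 * ((c₁ + R * (1 - z 0 ^ 2) /
        (1 + z 0 ^ 2)) ^ 2 + (c₂ + 2 * R * z 0 / (1 + z 0 ^ 2)) ^ 2)) ^ 2) W.domain)
    (hTd : T.domain = (fun z : Fin 2 → ℝ => ![z 1 * (c₁ + R * (1 - z 0 ^ 2) / (1 + z 0 ^ 2)),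
      z 1 * (c₂ + 2 * R * z 0 / (1 + z 0 ^ 2))]) '' W.domain)
    (hTi : EqOn T.integrand (fun p => 4 / (1 + p 0 ^ 2 + p 1 ^ 2) ^ 2) T.domain) :
    KZ.of W - KZ.of T ∈ KZ.relations := by
  -- the fan map
  set Φ : (Fin 2 → ℝ) → (Fin 2 → ℝ) := fun z : Fin 2 → ℝ =>
    ![z 1 * (c₁ + R * (1 - z 0 ^ 2) / (1 + z 0 ^ 2)), z 1 * (c₂ + 2 * R * z 0 / (1 + z 0 ^ 2))]
    with hΦdef
  have hΦ : ∀ z, Φ z = ![z 1 * (c₁ + R * (1 - z 0 ^ 2) / (1 + z 0 ^ 2)),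
      z 1 * (c₂ + 2 * R * z 0 / (1 + z 0 ^ 2))] := fun _ => rfl
  -- on the rectangle `λ > 0`
  have hsub : W.domain ⊆ {z | 0 < z 1} := fun z hz => by
    rw [hWd] at hz
    exact hz.2.2.1
  -- the data of the move
  have hΦsa : IsSemialgebraicMapOn ℚ W.domain Φ :=
    sphereFan_map_isSemialgebraicMapOn Φ hΦ hc₁ hc₂ hRa W.isSemialgebraic_domain
  have hinj : InjOn Φ W.domain := (sphereFan_map_injOn Φ hΦ hR2 hR0.ne').mono hsub
  choose Φ' hΦ'd hΦ'det using sphereFan_map_hasFDerivAt_det Φ hΦ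
  have hderiv : ∀ z ∈ W.domain, HasFDerivWithinAt Φ (Φ' z) W.domain z := fun z _ =>
    (hΦ'd z).hasFDerivWithinAt
  have himage : T.domain = Φ '' W.domain := hTd
  -- rule (2): `[W] − [T]` is one change-of-variables move
  refine KZ.changeOfVariablesRel_subset_relations
    ⟨2, W, T, Φ, Φ', hΦsa, hderiv, hinj, himage, fun z hz => ?_, rfl⟩
  have hzT : Φ z ∈ T.domain := himage ▸ mem_image_of_mem Φ hz
  have hz1 : 0 < z 1 := hsub hz
  have hJ := sphereFan_jac_pos c₁ c₂ hR2 (z 0)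
  rw [hWi hz, hTi hzT, hΦ'det z, abs_neg, abs_of_pos (mul_pos hz1 hJ)]
  beta_reduce
  rw [sphereFan_map_apply_zero Φ hΦ z, sphereFan_map_apply_one Φ hΦ z]
  ring

/-! ### The stub -/

/-- STUB `stub_sphereFan` (rule (2), ONE move — the fan map): `Φ(τ, λ) = λ·p(τ)` carries the
rectangle `(τ₁,τ₂) × (0,1)` (coordinates `z 0 = τ`, `z 1 = λ`) injectively onto the geodesic fan,
with Jacobian `λ·J(τ)` (`J = p × p′ > 0` because the origin is inside the circle:
`J(1+τ²) = 1 + P`), and `4λJ/(1+λ²P)² = (4/(1+|λp|²)²)·λJ`; so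
`[W] − [T] ∈ KZ.changeOfVariablesRel ⊆ KZ.relations` (`sphereFan_rect_sub_fan`).
[cite: KontsevichZagier2001, §1.2 rule (2)] -/
theorem stub_sphereFan :
    ∀ (c₁ c₂ R τ₁ τ₂ : ℝ), IsAlgebraic ℚ c₁ → IsAlgebraic ℚ c₂ → IsAlgebraic ℚ R →
      IsAlgebraic ℚ τ₁ → IsAlgebraic ℚ τ₂ → 0 < R → R ^ 2 = 1 + c₁ ^ 2 + c₂ ^ 2 → τ₁ < τ₂ →
    ∀ (W T : KZ.IntegralRep 2), W.domain = {z | τ₁ < z 0 ∧ z 0 < τ₂ ∧ 0 < z 1 ∧ z 1 < 1} →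
      Set.EqOn W.integrand (fun z => 4 * z 1 * ((c₁ + R * (1 - z 0 ^ 2) / (1 + z 0 ^ 2)) *
        (2 * R * (1 - z 0 ^ 2) / (1 + z 0 ^ 2) ^ 2) - (c₂ + 2 * R * z 0 / (1 + z 0 ^ 2)) *
        (-4 * R * z 0 / (1 + z 0 ^ 2) ^ 2)) / (1 + z 1 ^ 2 * ((c₁ + R * (1 - z 0 ^ 2) /
        (1 + z 0 ^ 2)) ^ 2 + (c₂ + 2 * R * z 0 / (1 + z 0 ^ 2)) ^ 2)) ^ 2) W.domain →
      T.domain = (fun z : Fin 2 → ℝ => ![z 1 * (c₁ + R * (1 - z 0 ^ 2) / (1 + z 0 ^ 2)),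
        z 1 * (c₂ + 2 * R * z 0 / (1 + z 0 ^ 2))]) '' W.domain →
      Set.EqOn T.integrand (fun p => 4 / (1 + p 0 ^ 2 + p 1 ^ 2) ^ 2) T.domain →
      KZ.of W - KZ.of T ∈ KZ.relations := by
  intro c₁ c₂ R τ₁ τ₂ hc₁ hc₂ hRa _ _ hR0 hR2 _ W T hWd hWi hTd hTi
  exact sphereFan_rect_sub_fan hc₁ hc₂ hRa hR0 hR2 W T hWd hWi hTd hTi

end Summit.KontsevichZagierPeriods.HyperbolicBloch.OffTetraSectorKernel

end
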